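import Literature.Probability.LatticeModels.LatticeWalkWinding
import Literature.Probability.LatticeModels.WeakBeurlingEstimate
import Literature.Probability.LatticeModels.GridDomainBoundaryHittingProofs
import Literature.Probability.LatticeModels.GridDomainConformalSteps
import HarnessLib

/-!
# Boundary hitting in grid domains (LSW 2004, Lemma 5.3) — proved steps, IV:
# the weak Beurling estimate for the walk killed at the boundary of a simply connected grid domain

Topic `Literature/Probability/LatticeModels`; fourth sibling of `GridDomainHittingProbability.lean`
(the named fact `boundaryHitting`, G. F. Lawler, O. Schramm, W. Werner, *Conformal invariance of
planar loop-erased random walks and uniform spanning trees*, Ann. Probab. 32 (2004), Lemma 5.3).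
The printed proof confines each round of the walk to a Euclidean neighbourhood of its starting
point of size comparable to the distance `r` to `∂D` ("`S_j` … the collection of all paths which
stay in `K_j` from the first time they hit `C(w, r/8)` until the first exit from `D`"); the
quantitative statement that the walk killed at `∂D` rarely travels much farther than `r` before
being killed is the **weak Beurling estimate** (Kesten 1987; Smirnov 2010, App. B, Lemma B.2),
which the tree proves for lattice-harmonic functions in the no-circuit form
`weakBeurling_of_noCircuit` (`WeakBeurlingEstimate.lean`).

This file transfers it to the killed walk of a grid domain:

* `LSWGrid.walkWinding_eq_zero_of_latticeVertices` — in a **simply connected** grid domain `D`,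
  a closed lattice walk through vertices of `V(D)` has winding number `0` about every lattice point
  outside `V(D)` (its polygon lies in `D`, by `IsGridDomain.ball_one_subset`, and
  `walkWinding_eq_zero_of_isSimplyConnected` of `LatticeWalkWinding.lean` applies);
* `LSWGrid.hitBeforeExitProb_compl_sqBox_le` — **weak Beurling for the killed walk**: for a
  lattice point `p ∉ V(D)` and `z ∈ V(D) ∩ sqBox p ρ`, the probability that the walk from `z`
  reaches a vertex of `V(D)` outside the box `sqBox p R` before being killed is at most
  `beurlingConst · ((ρ+1)/(R+1)) ^ beurlingExp` (the function
  `v ↦ hitBeforeExitProb D v (V(D) ∖ sqBox p R)` is lattice-harmonic on `V(D) ∩ sqBox p R`,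
  bounded by `1`, and vanishes at the sites of the box outside `V(D)`);
* `LSWGrid.exists_hitBeforeExitProb_compl_sqBox_le` — the form used in the proof of Lemma 5.3:
  for every `ε > 0` there is `K : ℕ` such that for all `D, p, ρ` as above the box of radius
  `K (ρ + 1)` is left alive with probability at most `ε`.

Everything here is proved; no definition and no named fact is introduced.

## References

* G. F. Lawler, O. Schramm, W. Werner, Ann. Probab. 32 (2004) 939–995, §5.1 [LawlerSchrammWerner2004].
* S. Smirnov, Ann. of Math. 172 (2010) 1435–1467, App. B, Lemma B.2 [Smirnov2010].
* H. Kesten, *Hitting probabilities of random walks on `ℤ^d`*, Stoch. Proc. Appl. 25 (1987) 165–184.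
-/

noncomputable section

open Set Metric Filter
open scoped Classical Topology
open Literature.Probability.RandomPlanarGeometry (ChordalLERW.siteGraph ChordalLERW.siteGraph_adj_iff)
open Literature.Probability.Percolation (walkWinding)

namespace Literature.Probability.LatticeModels

open WeakBeurling (sqBox sqBox_mono sqBox_finite beurlingConst beurlingExp beurlingExp_pos
  one_le_beurlingConst beurlingConst_pos)

namespace LSWGrid

variable {D : Set ℂ}

/-- In a simply connected grid domain a closed lattice walk through vertices of `V(D)` does not
wind around any lattice point outside `V(D)`: its polygon lies in `D` (every vertex carries the
unit disc `B(v, 1) ⊆ D`), and a loop in a simply connected open set has winding number zero about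
every point of the complement. [folklore] -/
theorem walkWinding_eq_zero_of_latticeVertices (hD : IsGridDomain D) (hsc : IsSimplyConnected D)
    {a : Site 2} (W : (zdGraph 2).Walk a a) (hW : ∀ v ∈ W.support, v ∈ latticeVertices D)
    {u : Site 2} (hu : u ∉ latticeVertices D) : walkWinding W u = 0 :=
  walkWinding_eq_zero_of_isSimplyConnected hD.1 hsc W
    (range_walkPath_subset_of_ball_subset W fun v hv => hD.ball_one_subset (hW v hv)) hu

/-- **The weak Beurling estimate for the walk killed at the boundary of a simply connected grid
domain** (Kesten; Smirnov 2010, Lemma B.2, through the tree's `weakBeurling_of_noCircuit`): if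
`p` is a lattice point outside `V(D)` and `z ∈ V(D)` lies in the box `sqBox p ρ`, the walk from
`z` reaches a vertex of `V(D)` outside `sqBox p R` before being killed with probability at most
`C ((ρ+1)/(R+1))^β`, `C = beurlingConst`, `β = beurlingExp`. [cite: Smirnov2010, App. B, Lemma B.2] -/
theorem hitBeforeExitProb_compl_sqBox_le (hD : IsGridDomain D) (hsc : IsSimplyConnected D)
    {p : Site 2} (hp : p ∉ latticeVertices D) (R ρ : ℕ) {z : Site 2}
    (hz : z ∈ latticeVertices D) (hzρ : z ∈ sqBox p ρ) :
    hitBeforeExitProb D z (latticeVertices D \ sqBox p R) ≤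
      beurlingConst * (((ρ : ℝ) + 1) / ((R : ℝ) + 1)) ^ beurlingExp := by
  set V := latticeVertices D with hV
  by_cases hzR : z ∈ sqBox p R
  · -- the harmonic function `h = hitBeforeExitProb D · (V ∖ box)` on `S = V ∩ box`
    set S : Set (Site 2) := V ∩ sqBox p R with hS
    have hSfin : S.Finite := (sqBox_finite p R).subset inter_subset_right
    set h : Site 2 → ℝ := fun v => hitBeforeExitProb D v (V \ sqBox p R) with hh
    have hharm : IsLatticeHarmonicOn h S := by
      intro v hv
      have hv' : v ∈ V \ (V \ sqBox p R) := ⟨hv.1, fun h' => h'.2 hv.2⟩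
      exact hitBeforeExitProb_isLatticeHarmonicOn (D := D) Set.sdiff_subset v hv'
    have h1 : ∀ w ∈ latticeOuterBoundary S, h w ≤ 1 := fun w _ => hitBeforeExitProb_le_one D w _
    have h0 : ∀ w ∈ latticeOuterBoundary S, w ∈ sqBox p R → h w = 0 := by
      intro w hw hwR
      have hwV : w ∉ V := fun hwV => hw.1 ⟨hwV, hwR⟩
      exact hitBeforeExitProb_eq_zero_of_not_mem (D := D) hwV fun h' => hwV h'.1
    have hW : ∀ (c : Site 2) (W : (zdGraph 2).Walk c c),
        (∀ x ∈ W.support, x ∈ S ∧ x ∈ sqBox p R) → walkWinding W p = 0 :=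
      fun c W hWS => walkWinding_eq_zero_of_latticeVertices hD hsc W (fun v hv => (hWS v hv).1.1) hp
    exact weakBeurling_of_noCircuit hSfin hharm h1 h0 hW ⟨hz, hzR⟩ hzρ
  · -- outside the box the bound is at least `beurlingConst ≥ 1`
    have hRρ : R < ρ := by
      by_contra hle
      exact hzR (sqBox_mono p (by exact_mod_cast not_lt.mp hle) hzρ)
    have hone : (1 : ℝ) ≤ ((ρ : ℝ) + 1) / ((R : ℝ) + 1) := by
      rw [le_div_iff₀ (by positivity)]
      have : (R : ℝ) < ρ := by exact_mod_cast hRρ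
      linarith
    calc hitBeforeExitProb D z (V \ sqBox p R) ≤ 1 := hitBeforeExitProb_le_one D z _
      _ ≤ beurlingConst * 1 := by rw [mul_one]; exact one_le_beurlingConst
      _ ≤ beurlingConst * (((ρ : ℝ) + 1) / ((R : ℝ) + 1)) ^ beurlingExp :=
        mul_le_mul_of_nonneg_left (Real.one_le_rpow hone beurlingExp_pos.le) beurlingConst_pos.le

/-- **Boxes are left alive with small probability, uniformly**: for every `ε > 0` there is
`K : ℕ` such that for every simply connected grid domain `D`, every lattice point `p ∉ V(D)`,
every `ρ : ℕ` and every `z ∈ V(D) ∩ sqBox p ρ`, the walk from `z` reaches a vertex of `V(D)`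
outside `sqBox p (K (ρ + 1))` before being killed with probability at most `ε`. [folklore] -/
theorem exists_hitBeforeExitProb_compl_sqBox_le {ε : ℝ} (hε : 0 < ε) :
    ∃ K : ℕ, 0 < K ∧ ∀ (D : Set ℂ), IsGridDomain D → IsSimplyConnected D →
      ∀ p : Site 2, p ∉ latticeVertices D → ∀ ρ : ℕ, ∀ z ∈ latticeVertices D, z ∈ sqBox p ρ →
        hitBeforeExitProb D z (latticeVertices D \ sqBox p (K * (ρ + 1))) ≤ ε := by
  -- `K ^ (-β) → 0`, so `C K^{-β} ≤ ε` for large `K`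
  have hlim : Tendsto (fun x : ℝ => beurlingConst * x ^ (-beurlingExp)) atTop (𝓝 0) := by
    simpa using (tendsto_rpow_neg_atTop beurlingExp_pos).const_mul beurlingConst
  obtain ⟨X, hX⟩ : ∃ X : ℝ, ∀ x ≥ X, beurlingConst * x ^ (-beurlingExp) ≤ ε := by
    obtain ⟨X, hX⟩ := (Filter.tendsto_atTop'.mp hlim) (Iic ε) (Iic_mem_nhds hε)
    exact ⟨X, fun x hx => hX x hx⟩
  obtain ⟨K, hK⟩ := exists_nat_gt (max X 1)
  have hK1 : (1 : ℝ) < K := lt_of_le_of_lt (le_max_right _ _) hK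
  have hKpos : 0 < K := by exact_mod_cast (zero_lt_one.trans hK1)
  refine ⟨K, hKpos, fun D hD hsc p hp ρ z hz hzρ => ?_⟩
  have hbound := hitBeforeExitProb_compl_sqBox_le hD hsc hp (K * (ρ + 1)) ρ hz hzρ
  refine hbound.trans ?_
  have hKε : beurlingConst * (K : ℝ) ^ (-beurlingExp) ≤ ε :=
    hX K (le_of_lt (lt_of_le_of_lt (le_max_left _ _) hK))
  refine le_trans ?_ hKε
  refine mul_le_mul_of_nonneg_left ?_ beurlingConst_pos.le
  have hK0 : (0 : ℝ) < K := by exact_mod_cast hKpos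
  rw [Real.rpow_neg hK0.le, ← Real.inv_rpow hK0.le]
  refine Real.rpow_le_rpow (by positivity) ?_ beurlingExp_pos.le
  rw [div_le_iff₀ (by positivity), Nat.cast_mul, Nat.cast_add, Nat.cast_one]
  have hρ0 : (0 : ℝ) ≤ ρ := Nat.cast_nonneg ρ
  have h1 : (K : ℝ)⁻¹ * ((K : ℝ) * ((ρ : ℝ) + 1) + 1) = (ρ + 1) + (K : ℝ)⁻¹ := by
    field_simp
  rw [h1]
  linarith [inv_pos.mpr hK0]

end LSWGrid

end Literature.Probability.LatticeModels
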